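import Summits.KontsevichZagierPeriods.KontsevichZagierPeriods.Theses.CompiledSubstitutions
import Summits.KontsevichZagierPeriods.KontsevichZagierPeriods.Theorems.HermiteRigidityGenusTwoCycleTransferPushforwardDimOne
import Literature.NumberTheory.Transcendental.SemialgebraicLineDeriv

/-!
# `FagnanoDoubling` (stmt-KontsevichZagierPeriods-3385, route CompiledSubstitutions)

The genus-1 calibration item "group law = ONE change of variables" of the route: Fagnano's
duplication of the lemniscatic arc,
`2 ∫₀^{1/2} dr/√(1 − r⁴) = ∫₀^{4√15/17} dr/√(1 − r⁴)`,
is ONE move of rule (2) of the Kontsevich–Zagier calculus. The change of variables is the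
lemniscatic doubling map
`φ(t) = 2t√(1 − t⁴)/(1 + t⁴)` (`sl(2u) = 2 sl u · sl′u / (1 + sl⁴u)`), for which

* `1 − φ(t)⁴ = ((1 − 6t⁴ + t⁸)/(1 + t⁴)²)²` (`one_sub_doubling_pow_four`), so that
  `√(1 − φ⁴) = (1 − 6t⁴ + t⁸)/(1 + t⁴)²` as long as `1 − 6t⁴ + t⁸ ≥ 0`, i.e. below the critical
  point `t⁴ = 3 − 2√2` (`t = √(√2 − 1) = 0.6436…`);
* `φ′(t) = 2(1 − 6t⁴ + t⁸)/(√(1 − t⁴)(1 + t⁴)²)` (`hasDerivAt_doubling`), positive on `(0, 1/2)`;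
* hence the rule-2 integrand identity `2/√(1 − t⁴) = (1/√(1 − φ(t)⁴))·|φ′(t)|`
  (`jacobian_identity`): `φ` pulls `dr/√(1 − r⁴)` back to `2dt/√(1 − t⁴)`;
* `φ` is strictly increasing and continuous on `[0, 1/2]`, `φ(0) = 0`, `φ(1/2) = 4√15/17`, so it maps
  `(0, 1/2)` bijectively onto `(0, 4√15/17)` (`image_doubling`);
* `p ↦ φ(p 0)` is a `ℚ`-semialgebraic function (closure of semialgebraic functions under
  `+, ·, √, ⁻¹`), so `Φ : p ↦ (φ(p 0))` is a `ℚ`-semialgebraic map of `ℝ¹`.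

`FagnanoDoubling_proof` concludes the route declaration
`Summit.KontsevichZagierPeriods.KontsevichZagierPeriods.Theses.CompiledSubstitutions.FagnanoDoubling`
by name: `[r] − [r'] ∈ KZ.changeOfVariablesRel ⊆ KZ.relations`, witnessed by `(Φ, Φ′ = φ′ • id)`.
No definitions are introduced; the doubling map is written out as the lambda
`fun t => 2 * t * √(1 - t ^ 4) / (1 + t ^ 4)` throughout. Reused from the tree:
`det_smul_id_fin_one`, `hasFDerivAt_fin_one` (HermiteRigidityGenusTwoCycleTransferPushforwardDimOne),
the semialgebraic-function toolkit of `Literature/NumberTheory/Transcendental/SemialgebraicLineDeriv`.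
No value (`= 1.0064188863…`) is computed: the move identifies the two integrals directly.

References: G. C. Fagnano (1718); H. McKean, V. Moll, *Elliptic Curves* (1997/1999), §2.3
("Fagnano's duplication"); M. Kontsevich, D. Zagier, *Periods* (2001), §1.2 rule (2).
-/

noncomputable section

open Set MeasureTheory
open Literature.NumberTheory.Transcendental Literature.ModelTheory.ExponentialFields
open Summit.KontsevichZagierPeriods.HermiteRigidity.GenusTwoCycleTransfer
  (det_smul_id_fin_one hasFDerivAt_fin_one)

namespace Summit.KontsevichZagierPeriods.CompiledSubstitutions.FagnanoDoubling

/-! ### Real-variable facts about the doubling map `φ(t) = 2t√(1 − t⁴)/(1 + t⁴)` -/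

/-- On `(0, 1/2)` one has `t⁴ < 1/16`. [folklore] -/
theorem pow_four_lt_of_mem_Ioo {t : ℝ} (ht : t ∈ Ioo (0 : ℝ) (1 / 2)) : t ^ 4 < 1 / 16 := by
  have h : t ^ 4 < (1 / 2) ^ 4 := pow_lt_pow_left₀ ht.2 ht.1.le (by norm_num)
  norm_num at h
  exact h

/-- On `[0, 1/2]` one has `t⁴ < 1`. [folklore] -/
theorem pow_four_lt_one_of_mem_Icc {t : ℝ} (ht : t ∈ Icc (0 : ℝ) (1 / 2)) : t ^ 4 < 1 :=
  pow_lt_one₀ ht.1 (by linarith [ht.2]) (by norm_num)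

/-- **The doubling identity on the lemniscate**: with `φ(t) = 2t√(1 − t⁴)/(1 + t⁴)`,
`1 − φ(t)⁴ = ((1 − 6t⁴ + t⁸)/(1 + t⁴)²)²` (for `t⁴ ≤ 1`, where `√(1 − t⁴)² = 1 − t⁴`).
[cite: MckeanMoll1999, §2.3] -/
theorem one_sub_doubling_pow_four (t : ℝ) (ht : t ^ 4 ≤ 1) :
    1 - (2 * t * Real.sqrt (1 - t ^ 4) / (1 + t ^ 4)) ^ 4 =
      ((1 - 6 * t ^ 4 + t ^ 8) / (1 + t ^ 4) ^ 2) ^ 2 := by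
  have h0 : (0 : ℝ) ≤ 1 - t ^ 4 := by linarith
  have hs : Real.sqrt (1 - t ^ 4) ^ 2 = 1 - t ^ 4 := Real.sq_sqrt h0
  have hd : (1 + t ^ 4 : ℝ) ≠ 0 := by positivity
  have h4 : Real.sqrt (1 - t ^ 4) ^ 4 = (1 - t ^ 4) ^ 2 := by
    rw [show Real.sqrt (1 - t ^ 4) ^ 4 = (Real.sqrt (1 - t ^ 4) ^ 2) ^ 2 by ring, hs]
  rw [div_pow, div_pow, mul_pow, h4]
  field_simp
  ring

/-- The doubling map `φ(t) = 2t√(1 − t⁴)/(1 + t⁴)` has derivative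
`φ′(t) = 2(1 − 6t⁴ + t⁸)/(√(1 − t⁴)(1 + t⁴)²)` wherever `t⁴ < 1`. [folklore] -/
theorem hasDerivAt_doubling {t : ℝ} (ht : t ^ 4 < 1) :
    HasDerivAt (fun t : ℝ => 2 * t * Real.sqrt (1 - t ^ 4) / (1 + t ^ 4))
      (2 * (1 - 6 * t ^ 4 + t ^ 8) / (Real.sqrt (1 - t ^ 4) * (1 + t ^ 4) ^ 2)) t := by
  have h0 : (0 : ℝ) < 1 - t ^ 4 := by linarith
  have hs0 : 0 < Real.sqrt (1 - t ^ 4) := Real.sqrt_pos.mpr h0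
  have hs : Real.sqrt (1 - t ^ 4) ^ 2 = 1 - t ^ 4 := Real.sq_sqrt h0.le
  have hd : (1 + t ^ 4 : ℝ) ≠ 0 := by positivity
  have h1 : HasDerivAt (fun t : ℝ => 1 - t ^ 4) (-(4 * t ^ 3)) t := by
    simpa using (hasDerivAt_pow 4 t).const_sub 1
  have h2 : HasDerivAt (fun t : ℝ => Real.sqrt (1 - t ^ 4))
      (-(4 * t ^ 3) / (2 * Real.sqrt (1 - t ^ 4))) t := h1.sqrt h0.ne'
  have h3 : HasDerivAt (fun t : ℝ => 2 * t) 2 t := by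
    simpa using (hasDerivAt_id t).const_mul 2
  have h4 := h3.mul h2
  have h5 : HasDerivAt (fun t : ℝ => 1 + t ^ 4) (4 * t ^ 3) t := by
    simpa using (hasDerivAt_pow 4 t).const_add 1
  refine (h4.div h5 hd).congr_deriv ?_
  simp only [Pi.mul_apply]
  field_simp
  linear_combination (2 - 6 * t ^ 4) * hs

/-- The derivative of the doubling map is positive on `(0, 1/2)` (indeed below the critical point
`t⁴ = 3 − 2√2`). [folklore] -/
theorem deriv_doubling_pos {t : ℝ} (ht : t ∈ Ioo (0 : ℝ) (1 / 2)) :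
    0 < 2 * (1 - 6 * t ^ 4 + t ^ 8) / (Real.sqrt (1 - t ^ 4) * (1 + t ^ 4) ^ 2) := by
  have ht4 := pow_four_lt_of_mem_Ioo ht
  have h8 : 0 ≤ t ^ 8 := by positivity
  have hN : 0 < 1 - 6 * t ^ 4 + t ^ 8 := by linarith
  have hs0 : 0 < Real.sqrt (1 - t ^ 4) := Real.sqrt_pos.mpr (by linarith)
  positivity

/-- The doubling map is continuous on `[0, 1/2]`. [folklore] -/
theorem continuousOn_doubling :
    ContinuousOn (fun t : ℝ => 2 * t * Real.sqrt (1 - t ^ 4) / (1 + t ^ 4)) (Icc (0 : ℝ) (1 / 2)) :=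
  fun _ ht => (hasDerivAt_doubling (pow_four_lt_one_of_mem_Icc ht)).continuousAt.continuousWithinAt

/-- The doubling map is strictly increasing on `[0, 1/2]` (positive derivative in the interior).
[folklore] -/
theorem strictMonoOn_doubling :
    StrictMonoOn (fun t : ℝ => 2 * t * Real.sqrt (1 - t ^ 4) / (1 + t ^ 4)) (Icc (0 : ℝ) (1 / 2)) := by
  refine strictMonoOn_of_deriv_pos (convex_Icc _ _) continuousOn_doubling ?_
  rw [interior_Icc]
  intro t ht
  rw [(hasDerivAt_doubling (pow_four_lt_one_of_mem_Icc (Ioo_subset_Icc_self ht))).deriv]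
  exact deriv_doubling_pos ht

/-- `φ(0) = 0`. [folklore] -/
theorem doubling_zero : 2 * (0 : ℝ) * Real.sqrt (1 - 0 ^ 4) / (1 + 0 ^ 4) = 0 := by simp

/-- **The Fagnano endpoint**: `φ(1/2) = 4√15/17`. [cite: MckeanMoll1999, §2.3] -/
theorem doubling_half :
    2 * (1 / 2 : ℝ) * Real.sqrt (1 - (1 / 2) ^ 4) / (1 + (1 / 2) ^ 4) = 4 * Real.sqrt 15 / 17 := by
  have h : Real.sqrt (1 - (1 / 2 : ℝ) ^ 4) = Real.sqrt 15 / 4 := by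
    rw [show (1 : ℝ) - (1 / 2) ^ 4 = 15 / 4 ^ 2 by norm_num, Real.sqrt_div' _ (by norm_num),
      Real.sqrt_sq (by norm_num)]
  rw [h]
  ring

/-- The doubling map sends `(0, 1/2)` into `(0, 4√15/17)`. [cite: MckeanMoll1999, §2.3] -/
theorem doubling_mem_Ioo {t : ℝ} (ht : t ∈ Ioo (0 : ℝ) (1 / 2)) :
    2 * t * Real.sqrt (1 - t ^ 4) / (1 + t ^ 4) ∈ Ioo (0 : ℝ) (4 * Real.sqrt 15 / 17) := by
  have h0 : (0 : ℝ) ∈ Icc (0 : ℝ) (1 / 2) := left_mem_Icc.2 (by norm_num)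
  have h1 : (1 / 2 : ℝ) ∈ Icc (0 : ℝ) (1 / 2) := right_mem_Icc.2 (by norm_num)
  have htI : t ∈ Icc (0 : ℝ) (1 / 2) := Ioo_subset_Icc_self ht
  have hl := strictMonoOn_doubling h0 htI ht.1
  have hr := strictMonoOn_doubling htI h1 ht.2
  beta_reduce at hl hr
  rw [doubling_zero] at hl
  rw [doubling_half] at hr
  exact ⟨hl, hr⟩

/-- Every point of `(0, 4√15/17)` is a value of the doubling map on `(0, 1/2)` (intermediate value
theorem). [cite: MckeanMoll1999, §2.3] -/
theorem exists_doubling_eq {y : ℝ} (hy : y ∈ Ioo (0 : ℝ) (4 * Real.sqrt 15 / 17)) :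
    ∃ t ∈ Ioo (0 : ℝ) (1 / 2), 2 * t * Real.sqrt (1 - t ^ 4) / (1 + t ^ 4) = y := by
  have h := intermediate_value_Ioo (by norm_num : (0 : ℝ) ≤ 1 / 2) continuousOn_doubling
  rw [doubling_zero, doubling_half] at h
  obtain ⟨t, ht, hty⟩ := h hy
  exact ⟨t, ht, hty⟩

/-- **The rule-2 integrand identity** of the doubling move:
`2/√(1 − t⁴) = (1/√(1 − φ(t)⁴))·|φ′(t)|` on `(0, 1/2)`. [cite: KontsevichZagier2001, §1.2 rule (2)] -/
theorem jacobian_identity {t : ℝ} (ht : t ∈ Ioo (0 : ℝ) (1 / 2)) :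
    2 / Real.sqrt (1 - t ^ 4) =
      1 / Real.sqrt (1 - (2 * t * Real.sqrt (1 - t ^ 4) / (1 + t ^ 4)) ^ 4) *
        |2 * (1 - 6 * t ^ 4 + t ^ 8) / (Real.sqrt (1 - t ^ 4) * (1 + t ^ 4) ^ 2)| := by
  have ht4 := pow_four_lt_of_mem_Ioo ht
  have h8 : 0 ≤ t ^ 8 := by positivity
  have hN : 0 < 1 - 6 * t ^ 4 + t ^ 8 := by linarith
  have hs0 : 0 < Real.sqrt (1 - t ^ 4) := Real.sqrt_pos.mpr (by linarith)
  have hd : (0 : ℝ) < (1 + t ^ 4) ^ 2 := by positivity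
  have hq : 0 ≤ (1 - 6 * t ^ 4 + t ^ 8) / (1 + t ^ 4) ^ 2 := by positivity
  rw [one_sub_doubling_pow_four t (by linarith), Real.sqrt_sq hq,
    abs_of_pos (deriv_doubling_pos ht), one_div_div, div_mul_div_comm,
    div_eq_div_iff hs0.ne' (mul_ne_zero hN.ne' (mul_ne_zero hs0.ne' hd.ne'))]
  ring

/-! ### The doubling map on `ℝ¹ = Fin 1 → ℝ` -/

/-- `p ↦ φ(p 0)` is a `ℚ`-semialgebraic function on every `ℚ`-semialgebraic subset of `ℝ¹`
(polynomials, `√`, products and inverses of semialgebraic functions are semialgebraic).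
[cite: BochnakCosteRoy1998, Prop. 2.2.6] -/
theorem isSemialgebraicFunOn_doubling {σ : Set (Fin 1 → ℝ)} (hσ : IsSemialgebraic ℚ σ) :
    IsSemialgebraicFunOn ℚ σ
      (fun p => 2 * p 0 * Real.sqrt (1 - p 0 ^ 4) / (1 + p 0 ^ 4)) := by
  have hA : IsSemialgebraicFunOn ℚ σ (fun p => 2 * p 0) :=
    (isSemialgebraicFunOn_aeval hσ (2 * MvPolynomial.X 0 : MvPolynomial (Fin 1) ℚ)).congr
      fun p _ => by simp
  have hB : IsSemialgebraicFunOn ℚ σ (fun p => 1 - p 0 ^ 4) :=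
    (isSemialgebraicFunOn_aeval hσ (1 - MvPolynomial.X 0 ^ 4 : MvPolynomial (Fin 1) ℚ)).congr
      fun p _ => by simp
  have hC : IsSemialgebraicFunOn ℚ σ (fun p => 1 + p 0 ^ 4) :=
    (isSemialgebraicFunOn_aeval hσ (1 + MvPolynomial.X 0 ^ 4 : MvPolynomial (Fin 1) ℚ)).congr
      fun p _ => by simp
  exact ((hA.fun_mul hB.fun_sqrt).fun_mul hC.fun_inv).congr fun p _ => by
    simp only [div_eq_mul_inv]

/-- **The image of `(0, 1/2)` under the doubling map is `(0, 4√15/17)`** (as subsets of `ℝ¹`).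
[cite: MckeanMoll1999, §2.3] -/
theorem image_doubling :
    (fun (p : Fin 1 → ℝ) (_ : Fin 1) => 2 * p 0 * Real.sqrt (1 - p 0 ^ 4) / (1 + p 0 ^ 4)) ''
        {p : Fin 1 → ℝ | p 0 ∈ Ioo (0 : ℝ) (1 / 2)} =
      {p : Fin 1 → ℝ | p 0 ∈ Ioo (0 : ℝ) (4 * Real.sqrt 15 / 17)} := by
  ext X
  simp only [mem_image, mem_setOf_eq]
  constructor
  · rintro ⟨p, hp, rfl⟩
    exact doubling_mem_Ioo hp
  · intro hX
    obtain ⟨t, ht, htX⟩ := exists_doubling_eq hX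
    refine ⟨fun _ => t, ht, ?_⟩
    funext i
    rw [Fin.fin_one_eq_zero i]
    exact htX

/-! ### The item: one move of rule (2) -/

/-- **`FagnanoDoubling`** (stmt-KontsevichZagierPeriods-3385): for any integral representations
`r = [(0, 1/2), 2/√(1 − x⁴)]` and `r' = [(0, 4√15/17), 1/√(1 − x⁴)]` of the KZ calculus (integrands
prescribed on the domains only), `KZ.Equivalent r r'` — in ONE change of variables (rule 2) along the
lemniscatic doubling map `Φ(p) = (φ(p 0))`, `φ(t) = 2t√(1 − t⁴)/(1 + t⁴)`: `Φ` is `ℚ`-semialgebraic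
and injective on `(0, 1/2)` with image `(0, 4√15/17)`, `DΦ = φ′ • id`, `det DΦ = φ′`, and the
Jacobian identity is `jacobian_identity`. This is Fagnano's duplication
`2∫₀^{1/2} dr/√(1 − r⁴) = ∫₀^{4√15/17} dr/√(1 − r⁴)` read inside the calculus.
[cite: KontsevichZagier2001, §1.2 rule (2)] -/
theorem FagnanoDoubling_proof :
    Summit.KontsevichZagierPeriods.KontsevichZagierPeriods.Theses.CompiledSubstitutions.FagnanoDoubling := by
  unfold Summit.KontsevichZagierPeriods.KontsevichZagierPeriods.Theses.CompiledSubstitutions.FagnanoDoubling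
  intro r r' h1 h2 h3 h4
  show KZ.of r - KZ.of r' ∈ KZ.relations
  refine KZ.changeOfVariablesRel_subset_relations ?_
  set Φ : (Fin 1 → ℝ) → (Fin 1 → ℝ) :=
    fun p _ => 2 * p 0 * Real.sqrt (1 - p 0 ^ 4) / (1 + p 0 ^ 4) with hΦ_def
  set Φ' : (Fin 1 → ℝ) → ((Fin 1 → ℝ) →L[ℝ] (Fin 1 → ℝ)) := fun p =>
    (2 * (1 - 6 * p 0 ^ 4 + p 0 ^ 8) / (Real.sqrt (1 - p 0 ^ 4) * (1 + p 0 ^ 4) ^ 2)) •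
      ContinuousLinearMap.id ℝ (Fin 1 → ℝ) with hΦ'_def
  have hdom : ∀ p ∈ r.domain, p 0 ∈ Ioo (0 : ℝ) (1 / 2) := fun p hp => by
    rw [h1] at hp
    exact hp
  -- Φ is a semialgebraic map, injective on σ, with derivative Φ' within σ
  have hΦsa : IsSemialgebraicMapOn ℚ r.domain Φ :=
    IsSemialgebraicMapOn.of_forall r.isSemialgebraic_domain fun _ =>
      isSemialgebraicFunOn_doubling r.isSemialgebraic_domain
  have hderiv : ∀ p ∈ r.domain, HasFDerivWithinAt Φ (Φ' p) r.domain p := fun p hp =>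
    (hasFDerivAt_fin_one (fun t : ℝ => 2 * t * Real.sqrt (1 - t ^ 4) / (1 + t ^ 4)) _ p
      (hasDerivAt_doubling (pow_four_lt_one_of_mem_Icc
        (Ioo_subset_Icc_self (hdom p hp))))).hasFDerivWithinAt
  have hinj : InjOn Φ r.domain := by
    intro p hp q hq h
    have h' : 2 * p 0 * Real.sqrt (1 - p 0 ^ 4) / (1 + p 0 ^ 4) =
        2 * q 0 * Real.sqrt (1 - q 0 ^ 4) / (1 + q 0 ^ 4) := congrFun h 0
    have hpq : p 0 = q 0 :=
      strictMonoOn_doubling.injOn (Ioo_subset_Icc_self (hdom p hp))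
        (Ioo_subset_Icc_self (hdom q hq)) h'
    funext i
    rw [Fin.fin_one_eq_zero i]
    exact hpq
  have himage : r'.domain = Φ '' r.domain := by
    rw [h3, h1]
    exact image_doubling.symm
  have hdet : ∀ p, (Φ' p).det =
      2 * (1 - 6 * p 0 ^ 4 + p 0 ^ 8) / (Real.sqrt (1 - p 0 ^ 4) * (1 + p 0 ^ 4) ^ 2) :=
    fun p => det_smul_id_fin_one _
  -- the Jacobian identity on σ
  have hjac : ∀ p ∈ r.domain, r.integrand p = r'.integrand (Φ p) * |(Φ' p).det| := by
    intro p hp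
    have hmem : Φ p ∈ r'.domain := himage ▸ mem_image_of_mem Φ hp
    rw [h2 hp, h4 hmem, hdet p]
    exact jacobian_identity (hdom p hp)
  exact ⟨1, r, r', Φ, Φ', hΦsa, hderiv, hinj, himage, hjac, rfl⟩

end Summit.KontsevichZagierPeriods.CompiledSubstitutions.FagnanoDoubling

end
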